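import Mathlib
import Summits.Ventures.PercRepro2.SureEdge
import Summits.Ventures.PercRepro2.CoincA3Main
import Summits.Ventures.PercRepro2.PocketBHK

/-!
# The mean field factorises across a root edge at `a₃`, and its first-order coefficient at the
coincidence `a₃ = a₁` is the mean-field T-row slack (blind cell PercRepro2, night-1 g17;
NIGHT1-G17.md §4)

Let `f = {a₃, a₁}` be an edge of weight `q = p f`.  The three masses `D = P(PD)`,
`D_o = P(PD, o ∈ U)`, `W = M₂ + Δ_T` vanish at `q = 1` (the sure edge identifies `a₃` with the root:
`PD = T = ∅`), so by the pinning identity each of them is `(1 − q)` times its value at `q = 0`, and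
the cleared mean field — a cubic form in the masses — factorises:

* **`HMFc_eq_factor`**: `HMFc = (1 − q) · Φ_f`, with the explicit cofactor
  `Φ_f = 2 Z [(1 − q) D_o⁰ W⁰ − X̂ D⁰] − gap [D_o⁰ (Z − S₃) − D⁰ (EQo − S₃o)]`
  (`Z = P(Q)`, `X̂`, `gap`, `S₃ = E_Q[σ₃]`, `S₃o = E_Q[σ₃ 1_{o∈U}]`, `EQo` at the weights `p`;
  superscript `0` = the weights with `f` removed);
* **`Phi_eq_of_sure`**: at `q = 1`, `Φ_f = −2 D⁰ [Z X̂ + gap · P(Q, o ∈ C₂)]` (the glued instance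
  `a₃ = a₁`, in which `S₃ = Z` and `EQo − S₃o = −2 P(Q, oH)`);
* **`Phi_nonneg_of_sure`**: this is `≥ 0` in EVERY graph — the bracket is the mean-field T-row
  inequality `PocketConn.mfT_le` with the roots exchanged (`X̂` at `a₃ = a₁` is the T-row sum over
  the clusters of `a₁`).

Hence `HMFc` vanishes to first order along the coincidence locus `a₃ = a₁` with a NONNEGATIVE
derivative: (HMF) holds to first order at the locus, for every graph and every weight vector; and
(HMF) at an instance with such an edge is equivalent (for `q < 1`) to `Φ_f ≥ 0`.

Own code; standard axioms.
-/

namespace Summit.Ventures.PercRepro2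

open UnionCluster CovForm

namespace RootEdge

section Events

variable {V : Type*} {E : Type*} (ends : E → Sym2 V) (a₁ a₂ : V)

/-- `T = {a₁ ∉ C₂, a₃ ∈ C₂}` is empty when `a₃ = a₁`. -/
lemma T_a1_eq_empty : TEvent ends a₁ a₂ a₁ = ∅ := by
  ext ω
  simp only [TEvent, Set.mem_inter_iff, Set.mem_compl_iff, mem_connEvent, Set.mem_empty_iff_false,
    iff_false, not_and]
  exact fun h => h

/-- `T′ = {a₂ ∉ C₁, a₃ ∈ C₁}` is `Q` when `a₃ = a₁`. -/
lemma T'_a1_eq : TEvent ends a₂ a₁ a₁ = avoidAll ends a₂ {a₁} := by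
  ext ω
  simp only [TEvent, Set.mem_inter_iff, Set.mem_compl_iff, mem_connEvent,
    PendantRoot.avoidAll_eq_compl]
  exact ⟨fun h => h.1, fun h => ⟨h, conn_refl ends ω a₁⟩⟩

/-- A row not containing `a₁` is not a cluster of `a₁`. -/
lemma clusterEvent_a1_eq_empty {W : Set V} (h : a₁ ∉ W) : clusterEvent ends a₁ W = ∅ := by
  ext ω
  simp only [mem_clusterEvent, Set.mem_empty_iff_false, iff_false]
  intro hW
  exact h (hW ▸ mem_cluster_self ends ω a₁)

/-- On a row containing `a₂`, the cluster of `a₁` being that row contradicts `Q`. -/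
lemma Q_inter_clusterEvent_a1_eq_empty {W : Set V} (h : a₂ ∈ W) :
    avoidAll ends a₂ {a₁} ∩ clusterEvent ends a₁ W = ∅ := by
  ext ω
  simp only [Set.mem_inter_iff, mem_clusterEvent, PendantRoot.avoidAll_eq_compl,
    Set.mem_compl_iff, mem_connEvent, Set.mem_empty_iff_false, iff_false, not_and]
  intro hQ hW
  exact hQ (mem_cluster.1 (hW ▸ h))

/-- On a row not containing `a₂`, the cluster of `a₁` being that row implies `Q`. -/
lemma Q_inter_clusterEvent_a1_eq {W : Set V} (h : a₂ ∉ W) :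
    avoidAll ends a₂ {a₁} ∩ clusterEvent ends a₁ W = clusterEvent ends a₁ W := by
  ext ω
  simp only [Set.mem_inter_iff, mem_clusterEvent, PendantRoot.avoidAll_eq_compl,
    Set.mem_compl_iff, mem_connEvent, and_iff_right_iff_imp]
  intro hW hc
  exact h (hW ▸ mem_cluster.2 hc)

end Events

section Factor

variable {V : Type*} {E : Type*} [Fintype E] [DecidableEq E] [Fintype V] [DecidableEq V]
  {R : Type*} [Field R] [LinearOrder R] [IsStrictOrderedRing R]

variable (p : E → R) (ends : E → Sym2 V) (o a₁ a₂ a₃ b : V) (f : E)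

/-- **The cofactor `Φ_f`** of `(1 − p f)` in `HMFc` for an edge `f = {a₃, a₁}`:
`2 Z [(1 − p f) D_o⁰ W⁰ − X̂ D⁰] − gap [D_o⁰ (Z − S₃) − D⁰ (EQo − S₃o)]`, the masses with
superscript `0` taken at the weights `p[f ↦ 0]`, the others at `p`. -/
noncomputable def Phi : R :=
  2 * prob p (avoidAll ends a₂ {a₁}) *
      ((1 - p f) * Do (Function.update p f 0) ends o a₁ a₂ a₃ *
          (massM2 (Function.update p f 0) ends a₁ a₂ a₃ b +
            deltaT (Function.update p f 0) ends a₁ a₂ a₃ b) -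
        Xhat p ends o a₁ a₂ a₃ b * prob (Function.update p f 0) (PDEvent ends a₁ a₂ a₃)) -
    gap p ends a₁ a₂ b *
      (Do (Function.update p f 0) ends o a₁ a₂ a₃ *
          (prob p (avoidAll ends a₂ {a₁}) - EQ3 p ends a₁ a₂ a₃) -
        prob (Function.update p f 0) (PDEvent ends a₁ a₂ a₃) *
          (EQo p ends o a₁ a₂ - EQ3o p ends o a₁ a₂ a₃))

variable {a₁ a₂ a₃ f}

omit [Fintype V] [DecidableEq V] [LinearOrder R] [IsStrictOrderedRing R] in
/-- With `f` pinned open, `PD`-masses vanish (`a₃` is identified with the root). -/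
lemma prob_PD_update_one (hf : ends f = s(a₃, a₁)) (X : Set (Config E)) :
    prob (Function.update p f 1) (PDEvent ends a₁ a₂ a₃ ∩ X) = 0 := by
  rw [SureEdge.prob_PD (Function.update p f 1) (by simp) hf a₁ a₂ X, Coinc.PD_a1_eq_empty,
    Set.empty_inter, prob_empty]

omit [Fintype V] [DecidableEq V] [LinearOrder R] [IsStrictOrderedRing R] in
/-- With `f` pinned open, `T`-masses vanish. -/
lemma prob_T_update_one (hf : ends f = s(a₃, a₁)) (X : Set (Config E)) :
    prob (Function.update p f 1) (X ∩ TEvent ends a₁ a₂ a₃) = 0 := by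
  rw [SureEdge.prob_T'' (Function.update p f 1) (by simp) hf a₁ a₂ X, T_a1_eq_empty,
    Set.inter_empty, prob_empty]

omit [LinearOrder R] [IsStrictOrderedRing R] in
/-- The pinning identity for a mass vanishing at `p f = 1`. -/
lemma prob_eq_of_update_one_eq_zero (A : Set (Config E))
    (h : prob (Function.update p f 1) A = 0) :
    prob p A = (1 - p f) * prob (Function.update p f 0) A := by
  rw [prob_eq_pin p A f, h]; ring

omit [LinearOrder R] [IsStrictOrderedRing R] in
/-- **The mean field factorises across a root edge at `a₃`**: `HMFc = (1 − p f) · Φ_f`. -/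
theorem HMFc_eq_factor (hf : ends f = s(a₃, a₁)) :
    HMFc p ends o a₁ a₂ a₃ b = (1 - p f) * Phi p ends o a₁ a₂ a₃ b f := by
  have hD := prob_eq_of_update_one_eq_zero p (PDEvent ends a₁ a₂ a₃)
    (by simpa using prob_PD_update_one p ends hf Set.univ)
  have hDoL := prob_eq_of_update_one_eq_zero p (PDEvent ends a₁ a₂ a₃ ∩ connEvent ends a₁ o)
    (prob_PD_update_one p ends hf _)
  have hDoH := prob_eq_of_update_one_eq_zero p (PDEvent ends a₁ a₂ a₃ ∩ connEvent ends a₂ o)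
    (prob_PD_update_one p ends hf _)
  have hM2 := prob_eq_of_update_one_eq_zero p (PDEvent ends a₁ a₂ a₃ ∩ connEvent ends a₂ b)
    (prob_PD_update_one p ends hf _)
  have hTbH := prob_eq_of_update_one_eq_zero p (connEvent ends a₂ b ∩ TEvent ends a₁ a₂ a₃)
    (prob_T_update_one p ends hf _)
  have hTbL := prob_eq_of_update_one_eq_zero p (connEvent ends a₁ b ∩ TEvent ends a₁ a₂ a₃)
    (prob_T_update_one p ends hf _)
  unfold HMFc CovForm.marginC CovForm.DEF Phi CovForm.Do massM2 deltaT
  rw [hD, hDoL, hDoH, hM2, hTbH, hTbL]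
  ring

end Factor

section Sure

variable {V : Type*} {E : Type*} [Fintype E] [DecidableEq E] [Fintype V] [DecidableEq V]
  {R : Type*} [Field R] [LinearOrder R] [IsStrictOrderedRing R]

variable (p : E → R) (ends : E → Sym2 V) (o a₁ a₂ a₃ b : V) {f : E}

omit [Fintype V] [DecidableEq V] [LinearOrder R] [IsStrictOrderedRing R] in
/-- At the sure edge, `E_Q[σ₃] = P(Q)`. -/
lemma EQ3_of_sure (hf : ends f = s(a₃, a₁)) (h1 : p f = 1) :
    EQ3 p ends a₁ a₂ a₃ = prob p (avoidAll ends a₂ {a₁}) := by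
  unfold EQ3
  rw [SureEdge.prob_T' p h1 hf a₁ a₂, SureEdge.prob_T' p h1 hf a₂ a₁, T_a1_eq_empty, T'_a1_eq,
    prob_empty, sub_zero]

omit [Fintype V] [DecidableEq V] [LinearOrder R] [IsStrictOrderedRing R] in
/-- At the sure edge, `E_Q[σ₃ 1_{o ∈ U}] = P(Q, o ∈ U)`. -/
lemma EQ3o_of_sure (hf : ends f = s(a₃, a₁)) (h1 : p f = 1) :
    EQ3o p ends o a₁ a₂ a₃ =
      prob p (avoidAll ends a₂ {a₁} ∩ connEvent ends a₁ o) +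
        prob p (avoidAll ends a₂ {a₁} ∩ connEvent ends a₂ o) := by
  unfold EQ3o
  rw [SureEdge.prob_T p h1 hf a₁ a₂, SureEdge.prob_T p h1 hf a₁ a₂, SureEdge.prob_T p h1 hf a₂ a₁,
    SureEdge.prob_T p h1 hf a₂ a₁, T_a1_eq_empty, T'_a1_eq]
  simp only [Set.empty_inter, prob_empty, sub_zero]

omit [LinearOrder R] [IsStrictOrderedRing R] in
/-- At the sure edge, the mean field is the T-row sum over the clusters of `a₁`. -/
lemma Xhat_of_sure (hf : ends f = s(a₃, a₁)) (h1 : p f = 1) :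
    Xhat p ends o a₁ a₂ a₃ b =
      ∑ W : Finset V, prob p (avoidAll ends a₂ {a₁} ∩ clusterEvent ends a₁ (↑W : Set V)) *
        termT p ends W o a₂ b := by
  rw [Xhat_eq_sum]
  refine Finset.sum_congr rfl fun W _ => ?_
  rw [SureEdge.prob_clusterEvent p h1 hf (↑W : Set V)]
  by_cases h1W : a₁ ∈ W
  · by_cases h2W : a₂ ∈ W
    · rw [termW, if_pos h1W, if_pos h2W, Q_inter_clusterEvent_a1_eq_empty ends a₁ a₂
        (Finset.mem_coe.2 h2W), prob_empty]
      ring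
    · rw [termW, if_pos h1W, if_neg h2W, Q_inter_clusterEvent_a1_eq ends a₁ a₂
        (fun h => h2W (Finset.mem_coe.1 h))]
  · rw [clusterEvent_a1_eq_empty ends a₁ (fun h => h1W (Finset.mem_coe.1 h)), Set.inter_empty,
      prob_empty]
    ring

omit [LinearOrder R] [IsStrictOrderedRing R] in
/-- **`Φ_f` at the sure edge**: `−2 D⁰ [Z X̂ + gap · P(Q, o ∈ C₂)]`. -/
theorem Phi_eq_of_sure (hf : ends f = s(a₃, a₁)) (h1 : p f = 1) :
    Phi p ends o a₁ a₂ a₃ b f =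
      -2 * prob (Function.update p f 0) (PDEvent ends a₁ a₂ a₃) *
        (prob p (avoidAll ends a₂ {a₁}) * Xhat p ends o a₁ a₂ a₃ b +
          gap p ends a₁ a₂ b * prob p (avoidAll ends a₂ {a₁} ∩ connEvent ends a₂ o)) := by
  unfold Phi
  rw [EQ3_of_sure p ends a₁ a₂ a₃ hf h1, EQ3o_of_sure p ends o a₁ a₂ a₃ hf h1, h1]
  unfold CovForm.EQo
  ring

/-- **The first-order coefficient at the coincidence is nonnegative in every graph**: at the sure
edge, `Φ_f ≥ 0` — the bracket is the mean-field T-row inequality with the roots exchanged. -/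
theorem Phi_nonneg_of_sure (hp : IsProbVec p) (hf : ends f = s(a₃, a₁)) (h1 : p f = 1) :
    0 ≤ Phi p ends o a₁ a₂ a₃ b f := by
  rw [Phi_eq_of_sure p ends o a₁ a₂ a₃ b hf h1]
  have hD : 0 ≤ prob (Function.update p f 0) (PDEvent ends a₁ a₂ a₃) :=
    prob_nonneg (hp.update f le_rfl zero_le_one) _
  -- the T-row inequality for the clusters of `a₁` (roots exchanged)
  have key := PocketConn.mfT_le p ends hp o a₂ a₁ b
  rw [connEvent_comm ends a₂ a₁, ← PendantRoot.avoidAll_eq_compl ends a₁ a₂] at key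
  rw [← Xhat_of_sure p ends o a₁ a₂ a₃ b hf h1] at key
  have hgap := CovForm.gap_eq_Q p ends a₁ a₂ b
  have hS : prob p (avoidAll ends a₂ {a₁}) * Xhat p ends o a₁ a₂ a₃ b +
      gap p ends a₁ a₂ b * prob p (avoidAll ends a₂ {a₁} ∩ connEvent ends a₂ o) ≤ 0 := by
    rw [hgap]; linarith [key]
  nlinarith [mul_nonneg hD (neg_nonneg.2 hS)]

end Sure

end RootEdge

end Summit.Ventures.PercRepro2
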